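import Literature.Topology.FourManifolds.SplitLinkSurgeryEmbeddings
import Literature.Topology.FourManifolds.SplitLinkSurgeryMu
import Literature.Topology.FourManifolds.RadialSaturation
import Literature.Topology.FourManifolds.GlobalFlatChart
import Literature.Topology.FourManifolds.TubularNbhdTrim
import Literature.Topology.FourManifolds.FlatteningChart
import Literature.Topology.FourManifolds.KirbyMovesShrinkProofs
import Literature.Topology.FourManifolds.KirbyMovesBlowDownProofs
import Literature.Topology.FourManifolds.KirbyMovesMirrorProofs
import Literature.Topology.FourManifolds.ConnectedSumSphereIdentity
import Literature.Topology.FourManifolds.KirbyCalculus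
import Literature.Topology.FourManifolds.KirbyMovesProofs
import Literature.Topology.FourManifolds.ConnectedSumProofs
import HarnessLib

/-!
# Surgery on the `0`-framed unlink is `#ⁿ (S² × S¹)`: surgery on a split link is a connected sum

Discharge of the named fact `Literature.Topology.FourManifolds.exists_isSurgery_zeroFramedUnlink`
(`KirbyCalculus.lean`; Gompf–Stipsicz (1999), §5.1, §5.3; Rolfsen (1976), §9.F): surgery on the
`0`-framed `n`-component split unlink `U` exists as a closed connected smooth `3`-manifold `Y`
with `IsSphereTwoProdCircleSum n Y`, i.e. `Y ≅ #ⁿ (S² × S¹)` in the inductive sense of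
`KirbyCalculus.lean` (`exists_isSurgery_zeroFramedUnlink_holds`).

## The geometric step: surgery on a split link is a connected sum

Let `Y` be presented as surgery on a link `L` (components indexed by `Option ι`) with tubular
neighbourhoods `ν`, and `Y'` as surgery on the link `L.someLink` of the components `some i` with
the same tubular neighbourhoods `ν (some i)`; let the component `K₀ = L.component none` be
flattened by a chart `Γ : ℝ³ → 𝕊 3` (`Knot.FlatChart` with `Ω = univ`) whose image misses the
other components and the unit tubes of their tubular neighbourhoods, with
`ν none = Γ ∘ flatTubeS h₀ δ` the flat tube; let `Z` be the open gluing of the unknot complement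
and the open solid torus along `surgeryRel ν_Z` for the flat tube
`ν_Z = R_N ∘ σ_N⁻¹ ∘ S₀ ∘ (2 •) ∘ flatTubeS h_Z δ` of the unknot (`exists_flatChart_unknot`), the
two flat tubes differing at most by the reflection of the fibre. Then **`Y` is a connected sum
`Y' # Z`** (`isConnectedSum_of_splitData`).

The proof is the *relative* version of the standard model `X # Sⁿ ≅ X` of
`ConnectedSumSphereIdentity.lean` (`ConnectedSumSphereData`: chart `Φ = (jA' ∘ Γ ∘ (16 •))⁻¹` of
`Y'` onto `ℝ³`, pole `N`, isometry `S₀`): the disc of `Y'` is `i₁ = Φ⁻¹`, the embedding of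
`Y' ∖ {i₁ 0}` into `Y` is `ι ∘ α` with `α` the transported puncture expansion and `ι` the
identification of `Y' ∖ jA'(Γ(B̄(0,2)))` with the corresponding part of `Y`
(`Link.exists_iotaEmbedding`); the disc of `Z` is `φ_Z ∘ σ_N⁻¹ ∘ S₀` (saturated off the unit
ball), and the embedding of `Z ∖ {φ_Z (-N)}` into `Y` is `φ_Z a ↦ jA (μ a)`,
`ψ_Z b ↦ jB none (T b)` for the transplant map `μ = Γ ∘ (16 •) ∘ g ∘ S₀⁻¹ ∘ σ_N ∘ R_N`
(`exists_transplantMap`, `exists_betaEmbedding`). The two pieces meet exactly along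
Kervaire–Milnor's relation by the identity `h (t • u) = g ((4/(1 - t)) • u)` linking the puncture
expansion and the ball contraction (`punctureExpansion_smul_eq`), as in
`ConnectedSumSphereData.α_eq_β_iff`.

From this, **surgery on a split link exists and is the connected sum of the surgeries**
(`Link.exists_surgery_isConnectedSum_of_smoothDisc`): flatten `K₀` by a global flattening chart
inside a neighbourhood `W` of its spanning disc off the other components
(`Knot.FlatChart.exists_flatChart_univ`), take the flat tube of framing `0` for `K₀` and tubes off
`W̄` for the other components (`Link.IsSurgeryPresentation.shrink_holds`,
`Knot.TubularNbhd.exists_trim`), build `Y` (`Link.exists_isSurgeryPresentation`), and present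
`S² × S¹` as `0`-surgery on the unknot with the flat tube of the global flattening chart of the
unknot (`exists_isOpenGluing_sphereTwoProdCircle`).

## The induction

For `n = 0` the surgery on the empty link is `S³` itself
(`FramedLink.isSurgery_sphereThree_of_isEmpty`). For `n = k + 1`, renumber the components by
`Option (Fin k)` (`FramedLink.isSurgery_reindex_iff_holds`); the components `some i` form a
`0`-framed `k`-component unlink, on which surgery `Y' ≅ #ᵏ (S² × S¹)` exists by induction; the
component `none` bounds a smooth disc missing the others and has framing `0`, so the surgery `Y`
on the whole link exists with `Y = Y' # (S² × S¹)`; `Y` is connected as a connected sum of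
connected `3`-manifolds (`IsConnectedSum.connectedSpace_holds`).

## References

* R. E. Gompf, A. I. Stipsicz, *4-Manifolds and Kirby Calculus* (1999), §5.1, §5.3 (surgery on
  the `0`-framed unlink; surgery on a split link is the connected sum of the surgeries).
* D. Rolfsen, *Knots and Links* (1976), §9.F.
* M. A. Kervaire, J. W. Milnor, *Groups of homotopy spheres: I*, Ann. of Math. 77 (1963), §2.
* A. Kosinski, *Differential Manifolds* (1993), Ch. VI §1 (1.3), §6.
-/

open scoped Manifold ContDiff Topology RealInnerProductSpace
open Set Function Metric Module Filter

noncomputable section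

namespace Literature.Topology.FourManifolds

/-- Local notation: `𝔼 n` is the model Euclidean space `EuclideanSpace ℝ (Fin n)`. -/
local notation "𝔼 " n:arg => EuclideanSpace ℝ (Fin n)

/-- Local notation: `𝕊 n` is the unit sphere in `EuclideanSpace ℝ (Fin (n + 1))`. -/
local notation "𝕊 " n:arg => (Metric.sphere (0 : EuclideanSpace ℝ (Fin (n + 1))) 1)

attribute [local instance] fact_finrank_euclideanSpace_two fact_finrank_euclideanSpace_four

open BlowDownFlat

/-! ### The radial saturation of a Euclidean space -/

/-- **The radial saturation of a finite-dimensional inner product space** (the statement of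
`exists_planeSaturation` in any dimension): for `0 < ε` there is a `C^∞` injective map which is
the identity on the closed unit ball, maps everything into the open ball of radius `1 + ε`, and is
a local diffeomorphism at every point. [folklore] -/
theorem exists_saturationMap {E : Type*} [NormedAddCommGroup E] [InnerProductSpace ℝ E]
    [FiniteDimensional ℝ E] {ε : ℝ} (hε : 0 < ε) :
    ∃ lam : E → E, ContDiff ℝ ∞ lam ∧ Injective lam ∧ (∀ w, ‖w‖ ≤ 1 → lam w = w) ∧
      (∀ w, ‖lam w‖ < 1 + ε) ∧ ∀ w, IsLocalDiffeomorphAt 𝓘(ℝ, E) 𝓘(ℝ, E) ∞ lam w := by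
  have hab : (1 : ℝ) < 1 + ε := by linarith
  obtain ⟨ℓ, hℓs, hℓd, -, hℓid, hℓlt, hℓge⟩ := exists_saturationProfile hab
  set φ : ℝ → ℝ := fun s ↦ if s ≤ 1 / 4 then 1 else ℓ (Real.sqrt s) / Real.sqrt s with hφ
  have hφ_one : ∀ s, s ≤ 1 → φ s = 1 := by
    intro s hs
    simp only [hφ]
    split_ifs with h
    · rfl
    · have hs0 : 0 < s := by linarith
      rw [hℓid _ (Real.sqrt_le_one.mpr hs), div_self (Real.sqrt_pos.2 hs0).ne']
  have hφ_gt : ∀ s, 1 / 4 < s → φ s = ℓ (Real.sqrt s) / Real.sqrt s := by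
    intro s hs; simp only [hφ, if_neg (not_le.2 hs)]
  have hrad : ∀ t, 0 ≤ t → t * φ (t ^ 2) = ℓ t := by
    intro t ht
    by_cases h : t ^ 2 ≤ 1
    · rw [hφ_one _ h, mul_one, hℓid]
      nlinarith
    · rw [hφ_gt _ (by linarith [not_le.1 h]), Real.sqrt_sq ht]
      have ht0 : 0 < t := by
        rcases eq_or_lt_of_le ht with rfl | h'
        · norm_num at h
        · exact h'
      field_simp
  have hφs : ∀ s, 0 ≤ s → ContDiffAt ℝ ∞ φ s := by
    intro s hs
    by_cases h : s < 1
    · exact contDiffAt_const.congr_of_eventuallyEq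
        (Filter.eventually_of_mem (Iio_mem_nhds h) fun s' hs' ↦ hφ_one s' (le_of_lt hs'))
    · have hs4 : 1 / 4 < s := by linarith [not_lt.1 h]
      have h1 : ContDiffAt ℝ ∞ Real.sqrt s := Real.contDiffAt_sqrt (by linarith)
      exact ((hℓs.contDiffAt.comp s h1).div h1 (Real.sqrt_pos.2 (by linarith)).ne').congr_of_eventuallyEq
        (Filter.eventually_of_mem (Ioi_mem_nhds hs4) fun s' hs' ↦ hφ_gt s' hs')
  have hφpos : ∀ t, 0 ≤ t → 0 < φ (t ^ 2) := by
    intro t ht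
    by_cases h : t ^ 2 ≤ 1
    · rw [hφ_one _ h]; exact one_pos
    · have ht1 : 1 < t := by nlinarith [not_le.1 h]
      rw [hφ_gt _ (by linarith [not_le.1 h]), Real.sqrt_sq ht]
      exact div_pos (by linarith [hℓge t ht1.le]) (by linarith)
  have hder : ∀ t, 0 ≤ t → 0 < φ (t ^ 2) + 2 * t ^ 2 * deriv φ (t ^ 2) := by
    intro t ht
    by_cases h : t ^ 2 < 1
    · have hev : φ =ᶠ[𝓝 (t ^ 2)] fun _ ↦ (1 : ℝ) :=
        Filter.eventually_of_mem (Iio_mem_nhds h) fun s' hs' ↦ hφ_one s' (le_of_lt hs')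
      rw [hev.deriv_eq, deriv_const, mul_zero, add_zero, hφ_one _ h.le]
      exact one_pos
    · have hdφ : HasDerivAt φ (deriv φ (t ^ 2)) (t ^ 2) :=
        ((hφs _ (sq_nonneg t)).differentiableAt (by simp)).hasDerivAt
      rw [← (hasDerivAt_radialProfile hdφ).deriv]
      have hev : (fun t : ℝ ↦ t * φ (t ^ 2)) =ᶠ[𝓝 t] ℓ :=
        Filter.eventually_of_mem (Ioi_mem_nhds (by nlinarith [not_lt.1 h] : (0 : ℝ) < t))
          fun t' ht' ↦ hrad t' (le_of_lt ht')
      rw [hev.deriv_eq]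
      exact hℓd t
  obtain ⟨hinj, hsmooth, Λ, hΛf, hsrc, htgt, -, hsymm⟩ :=
    exists_openPartialHomeomorph_radial (E := E) hφs hφpos hder
  refine ⟨fun w ↦ φ (‖w‖ ^ 2) • w, hsmooth, hinj, fun w hw ↦ ?_, fun w ↦ ?_, fun w ↦ ?_⟩
  · show φ (‖w‖ ^ 2) • w = w
    rw [hφ_one _ (by nlinarith [norm_nonneg w]), one_smul]
  · show ‖φ (‖w‖ ^ 2) • w‖ < 1 + ε
    rw [norm_smul, Real.norm_eq_abs, abs_of_pos (hφpos _ (norm_nonneg w)), mul_comm,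
      hrad _ (norm_nonneg w)]
    exact hℓlt _
  · exact isLocalDiffeomorphAt_of_contDiffOn_openPartialHomeomorph Λ (by rw [hsrc]; trivial)
      (by rw [hΛf, hsrc]; exact hsmooth.contDiffOn) (by rw [htgt]; exact hsymm)
      (Filter.Eventually.of_forall fun w ↦ by rw [hΛf])

/-! ### The relative standard model -/

section Core

variable {ι : Type*} [Finite ι]

set_option maxHeartbeats 4000000 in
/-- **Surgery on a split link is the connected sum of the surgeries — the relative standard
model.** See the module docstring for the setting and the construction. Data: presentations
`(jA, jB)` of `Y` on `L` with tubular neighbourhoods `ν` and `(jA', jB')` of `Y'` on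
`L.someLink` with the tubular neighbourhoods `ν (some i)`; a flattening chart `Φ₀` of
`K₀ = L.component none` on all of `ℝ³` whose image lies in the complement of the other
components and misses the open unit tubes of `ν (some i)`, with `ν none = Φ₀.Γ ∘ flatTubeS h₀ δ`;
the pole `N`, isometry `S₀` and tube `ν_Z = R_N ∘ σ_N⁻¹ ∘ S₀ ∘ (2 •) ∘ flatTubeS h_Z δ` of the
unknot with `flatTubeS h_Z δ (x, w) = flatTubeS h₀ δ (x, Fw w)`, `Fw (t • v) = t • Fs v`,
`T (p, v) = (p, Fs v)`; an open gluing `(φ_Z, ψ_Z)` of the unknot complement and the solid torus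
along `surgeryRel ν_Z` presenting `Z`. Conclusion: `IsConnectedSum (𝓡 3) (𝓡 3) IZ Y' Z Y`
(Kervaire–Milnor (1963), §2; Kosinski (1993), VI (1.3); Gompf–Stipsicz (1999), §5.3: surgery on
a split link). [cite: KervaireMilnor1963, §2] -/
theorem isConnectedSum_of_splitData {L : Link (Option ι)} (ν : ∀ i, Knot.TubularNbhd (L.component i))
    {Y : Type*} [TopologicalSpace Y] [ChartedSpace (𝔼 3) Y] [IsManifold (𝓡 3) ∞ Y]
    {jA : L.complement → Y} {jB : Option ι → solidTorus → Y}
    (hA : Manifold.IsSmoothEmbedding (𝓡 3) (𝓡 3) ∞ jA) (hAo : IsOpen (range jA))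
    (hB : ∀ i, Manifold.IsSmoothEmbedding (𝓘(ℝ, 𝔼 2).prod (𝓡 1)) (𝓡 3) ∞ (jB i) ∧
      IsOpen (range (jB i)))
    (hcov : range jA ∪ (⋃ i, range (jB i)) = univ)
    (hdisj : Pairwise fun i j ↦ Disjoint (range (jB i)) (range (jB j)))
    (hrel : ∀ i a b, jA a = jB i b ↔ Link.surgeryRel ν i a b)
    {Y' : Type*} [TopologicalSpace Y'] [T2Space Y'] [ChartedSpace (𝔼 3) Y']
    [IsManifold (𝓡 3) ∞ Y'] {jA' : L.someLink.complement → Y'} {jB' : ι → solidTorus → Y'}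
    (hA' : Manifold.IsSmoothEmbedding (𝓡 3) (𝓡 3) ∞ jA') (hAo' : IsOpen (range jA'))
    (hB' : ∀ i, Manifold.IsSmoothEmbedding (𝓘(ℝ, 𝔼 2).prod (𝓡 1)) (𝓡 3) ∞ (jB' i) ∧
      IsOpen (range (jB' i)))
    (hcov' : range jA' ∪ (⋃ i, range (jB' i)) = univ)
    (hdisj' : Pairwise fun i j ↦ Disjoint (range (jB' i)) (range (jB' j)))
    (hrel' : ∀ i a b, jA' a = jB' i b ↔ Link.surgeryRel (fun i ↦ ν (some i)) i a b)
    (Φ₀ : (L.component none).FlatChart) (hΩ : Φ₀.Ω = univ)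
    (hΓmem : ∀ y, Φ₀.Γ y ∈ L.someLink.complement)
    (hΓν : ∀ (i : ι) (x : 𝕊 1) (w : 𝔼 2), ‖w‖ < 1 → ν (some i) (x, w) ∉ range Φ₀.Γ)
    {h₀ hZ δ : ℝ} (hh₀ : h₀ ^ 2 = 1) (hhZ : hZ ^ 2 = 1) (hδ : 0 < δ) (hδ4 : δ ≤ 1 / 4)
    (hν₀ : ∀ q, ν none q = Φ₀.Γ (flatTubeS h₀ δ q))
    (N : 𝕊 3) (S₀ : 𝔼 3 ≃ₗᵢ[ℝ] 𝔼 3)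
    (hcircle : ∀ u : 𝕊 1, (stereographic' 3 N).symm (S₀ ((2 : ℝ) • flatCircle u)) = unknot u)
    (νZ : Knot.TubularNbhd unknot)
    (hνZ : ∀ q, νZ q = poleReflectionSphere (n := 3) N
      ((stereographic' 3 N).symm (S₀ ((2 : ℝ) • flatTubeS hZ δ q))))
    (Fs : 𝕊 1 → 𝕊 1) (Fw : 𝔼 2 → 𝔼 2)
    (hFw : ∀ (t : ℝ) (v : 𝕊 1), Fw (t • (v : 𝔼 2)) = t • (Fs v : 𝔼 2))
    (T : solidTorus ≃ₘ⟮𝓘(ℝ, 𝔼 2).prod (𝓡 1), 𝓘(ℝ, 𝔼 2).prod (𝓡 1)⟯ solidTorus)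
    (hT : ∀ b : solidTorus, ((T b : solidTorus) : (𝔼 2) × (𝕊 1)) =
      ((b : (𝔼 2) × (𝕊 1)).1, Fs (b : (𝔼 2) × (𝕊 1)).2))
    (hflip : ∀ (x : 𝕊 1) (w : 𝔼 2), flatTubeS hZ δ (x, w) = flatTubeS h₀ δ (x, Fw w))
    {EZ HZ : Type*} [NormedAddCommGroup EZ] [NormedSpace ℝ EZ] [TopologicalSpace HZ]
    {IZ : ModelWithCorners ℝ EZ HZ} [IZ.Boundaryless] {Z : Type*} [TopologicalSpace Z] [T2Space Z]
    [ChartedSpace HZ Z] [IsManifold IZ ∞ Z] (LZ : EZ ≃L[ℝ] 𝔼 3)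
    {φZ : (unknot).complement → Z} {ψZ : solidTorus → Z}
    (hφ : Manifold.IsSmoothEmbedding (𝓡 3) IZ ∞ φZ) (hφo : IsOpen (range φZ))
    (hψ : Manifold.IsSmoothEmbedding (𝓘(ℝ, 𝔼 2).prod (𝓡 1)) IZ ∞ ψZ) (hψo : IsOpen (range ψZ))
    (hcovZ : range φZ ∪ range ψZ = univ) (hrelZ : ∀ a b, φZ a = ψZ b ↔ surgeryRel νZ a b) :
    IsConnectedSum (𝓡 3) (𝓡 3) IZ Y' Z Y := by
  set σ := stereographic' 3 N with hσ
  set R := poleReflectionSphere (n := 3) N with hR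
  set g : 𝔼 3 → 𝔼 3 := ballContraction with hg
  have hmemΩ : ∀ w, w ∈ Φ₀.Ω := fun w ↦ by rw [hΩ]; trivial
  have hΓinj : Injective Φ₀.Γ := fun v w h ↦ Φ₀.injOn (hmemΩ v) (hmemΩ w) h
  have hRR : ∀ a, R (R a) = a := poleReflectionSphere_poleReflectionSphere (n := 3) N
  have hRneg : R (-N) = N := by
    have h := hRR N; rwa [hR, poleReflectionSphere_pole] at h
  have hσne : ∀ x : 𝔼 3, σ.symm x ≠ N := stereographic'_symm_ne N
  have hnfc : ∀ u : 𝕊 1, ‖flatCircle u‖ = 1 := fun u ↦ by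
    have h := norm_sq_eq_three (flatCircle u)
    have h0 : flatCircle u 0 = (u : 𝔼 2) 0 := rfl
    have h1 : flatCircle u 1 = (u : 𝔼 2) 1 := rfl
    have h2 : flatCircle u 2 = 0 := rfl
    rw [h0, h1, h2, sphere_sq u] at h
    nlinarith [norm_nonneg (flatCircle u)]
  -- `-N` is off the unknot
  have hNmem : -N ∈ (unknot).complement := by
    rw [SphereEmbedding.mem_complement_iff]
    rintro ⟨u, hu⟩
    rw [← hcircle u, ← stereographic'_symm_zero (n := 3) N] at hu
    have h2 : S₀ ((2 : ℝ) • flatCircle u) = 0 := stereographic'_symm_injective_sphereThree N hu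
    rw [← S₀.map_zero] at h2
    have h3 := S₀.injective h2
    have h4 : ‖(2 : ℝ) • flatCircle u‖ = 0 := by rw [h3, norm_zero]
    rw [norm_smul, hnfc, mul_one] at h4
    norm_num at h4
  -- the chart of `Y'` and the standard-model data
  obtain ⟨e, het, hes, hesymm, he4, hesrc, hiemb⟩ :=
    exists_chart_of_flatChart hA' Φ₀ hΩ hΓmem (c := (16 : ℝ)) (by norm_num)
  set D' : ConnectedSumSphereData (𝔼 4) 3 Y' := ⟨e, het, hes, hesymm, N, S₀⟩ with hD'
  have hi₁ : ∀ y, D'.i₁ y = jA' ⟨Φ₀.Γ ((16 : ℝ) • y), hΓmem _⟩ := fun y ↦ by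
    rw [ConnectedSumSphereData.i₁_def]; exact he4 y
  -- the closed set `C = Γ (B̄(0, 2))`
  set C : Set (𝕊 3) := Φ₀.Γ '' Metric.closedBall 0 2 with hC
  have hΓcont : Continuous Φ₀.Γ := by
    have := Φ₀.continuousOn; rwa [hΩ, continuousOn_univ] at this
  have hCc : IsClosed C := ((isCompact_closedBall _ _).image hΓcont).isClosed
  have hKC : range (L.component none) ⊆ C := by
    rintro _ ⟨u, rfl⟩
    refine ⟨flatCircle u, ?_, Φ₀.apply_flatCircle u⟩
    rw [Metric.mem_closedBall, dist_zero_right, hnfc]; norm_num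
  have hnotC : ∀ w : 𝔼 3, 2 < ‖w‖ → Φ₀.Γ w ∉ C := by
    rintro w hw ⟨v, hv, hvw⟩
    rw [hΓinj hvw, Metric.mem_closedBall, dist_zero_right] at hv
    linarith
  have hνC : ∀ (i : ι) (x : 𝕊 1) (w : 𝔼 2), ‖w‖ < 1 → ν (some i) (x, w) ∉ C := fun i x w hw hmem ↦
    hΓν i x w hw ((image_subset_range _ _) hmem)
  -- the open piece `Uα` of `Y'`
  have hUα : (D'.Uα : Set Y') = (jA' '' {a | (a : 𝕊 3) ∈ C})ᶜ := by
    ext y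
    rw [SetLike.mem_coe, ConnectedSumSphereData.mem_Uα, mem_compl_iff, not_iff_not]
    constructor
    · rintro ⟨z, hz, rfl⟩
      refine ⟨⟨Φ₀.Γ ((16 : ℝ) • z), hΓmem _⟩, ⟨(16 : ℝ) • z, ?_, rfl⟩, (hi₁ z).symm⟩
      rw [Metric.mem_closedBall, dist_zero_right] at hz ⊢
      rw [norm_smul, Real.norm_eq_abs, abs_of_pos (by norm_num : (0 : ℝ) < 16)]
      linarith
    · rintro ⟨a, ⟨v, hv, hva⟩, rfl⟩
      refine ⟨(16 : ℝ)⁻¹ • v, ?_, ?_⟩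
      · rw [Metric.mem_closedBall, dist_zero_right] at hv ⊢
        rw [norm_smul, Real.norm_eq_abs, abs_of_pos (by norm_num : (0 : ℝ) < 16⁻¹)]
        linarith
      · rw [hi₁, smul_smul, mul_inv_cancel₀ (by norm_num : (16 : ℝ) ≠ 0), one_smul]
        congr 1
        exact Subtype.ext hva
  -- the embedding `ι : Uα ↪ Y`
  obtain ⟨ιU, hιU, hιUo, hιUA, hιUB, hιUrange⟩ := Link.exists_iotaEmbedding ν hA hAo hB hdisj hrel
    hA' hAo' hB' hcov' hdisj' hrel' hCc hKC hνC D'.Uα hUα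
  -- the transplant map
  obtain ⟨μ, μinv, hμf, hμs, hμinvs, hμo, hleft, hμK, hμcov, hμflat⟩ :=
    exists_transplantMap Φ₀ hΩ N S₀ hcircle
  have hμmemL : ∀ a, a ∉ range unknot → a ≠ -N → μ a ∈ L.complement := by
    intro a haO haN
    have h1 : μ a ∈ L.someLink.complement := by rw [hμf]; exact hΓmem _
    rw [Link.mem_complement_iff] at h1 ⊢
    rintro (_ | i) hx
    · exact haO (hμK a haN hx)
    · exact h1 i (by simpa using hx)
  have hq₀ν : ∀ (x : 𝕊 1) (w : 𝔼 2), ‖w‖ < 1 → νZ (x, w) ≠ -N := fun x w _ h ↦ by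
    rw [hνZ] at h
    exact hσne _ (by rw [← hRneg, ← h, hRR])
  have hμν : ∀ (x : 𝕊 1) (w : 𝔼 2), ‖w‖ < 1 → μ (νZ (x, w)) = ν none (x, Fw w) := fun x w _ ↦ by
    rw [hνZ, hμflat _ ((norm_flatTubeS_lt_two hhZ hδ hδ4 _).trans (by norm_num)), hflip, hν₀]
  -- the saturated round disc of `Z` and the puncture
  obtain ⟨lam, hlams, hlaminj, hlamid, hlamlt, hlamloc⟩ :=
    exists_saturationMap (E := 𝔼 3) (by norm_num : (0 : ℝ) < 1 / 2)
  have hlam0 : lam 0 = 0 := hlamid 0 (by simp)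
  have hi₂mem : ∀ x : 𝔼 3, D'.i₂ (lam x) ∈ (unknot).complement := by
    intro x
    rw [SphereEmbedding.mem_complement_iff]
    rintro ⟨u, hu⟩
    rw [← hcircle u, ConnectedSumSphereData.i₂_apply] at hu
    have h1 := S₀.injective (stereographic'_symm_injective_sphereThree N hu)
    have h2 : ‖(2 : ℝ) • flatCircle u‖ = ‖lam x‖ := by rw [h1]
    rw [norm_smul, hnfc, mul_one, Real.norm_eq_abs, abs_of_pos two_pos] at h2
    linarith [hlamlt x]
  set gZ : 𝔼 3 → (unknot).complement := fun x ↦ ⟨D'.i₂ (lam x), hi₂mem x⟩ with hgZ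
  have hgZloc : IsLocalDiffeomorph 𝓘(ℝ, 𝔼 3) (𝓡 3) ∞ gZ := by
    have h1 : IsLocalDiffeomorph 𝓘(ℝ, 𝔼 3) (𝓡 3) ∞ (fun x ↦ D'.i₂ (lam x)) := fun x ↦ by
      have h2 : IsLocalDiffeomorphAt 𝓘(ℝ, 𝔼 3) 𝓘(ℝ, 𝔼 3) ∞ (S₀ ∘ lam) x :=
        IsLocalDiffeomorphAt.comp (hf := hlamloc x)
          (hg := S₀.toContinuousLinearEquiv.toDiffeomorph.isLocalDiffeomorph _)
      exact IsLocalDiffeomorphAt.comp (hf := h2)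
        (hg := isLocalDiffeomorphAt_stereographic'_symm_sphereThree N _)
    exact h1.codRestrict_opens _ hi₂mem
  have hgZinj : Injective gZ := fun x y h ↦
    hlaminj (D'.injective_i₂ (congrArg Subtype.val h))
  have hgZemb : Manifold.IsSmoothEmbedding 𝓘(ℝ, 𝔼 3) (𝓡 3) ∞ gZ :=
    isSmoothEmbedding_of_isLocalDiffeomorph hgZloc hgZinj (ContinuousLinearEquiv.refl ℝ _)
  have hgZo : Topology.IsOpenEmbedding gZ := ⟨hgZemb.isEmbedding, hgZloc.isOpen_range⟩
  haveI : Nonempty (𝔼 3) := ⟨0⟩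
  set ΨZ := hgZo.toOpenPartialHomeomorph gZ with hΨZ
  have hΨZg : ⇑ΨZ = gZ := hgZo.toOpenPartialHomeomorph_apply gZ
  have hΨZsrc : ΨZ.source = univ := hgZo.toOpenPartialHomeomorph_source gZ
  have hΨZtgt : ΨZ.target = range gZ := hgZo.toOpenPartialHomeomorph_target gZ
  set i₂Z : 𝔼 3 → Z := φZ ∘ ΨZ with hi₂Z
  have hi₂Zapp : ∀ x, i₂Z x = φZ ⟨D'.i₂ (lam x), hi₂mem x⟩ := fun x ↦ by
    change φZ (ΨZ x) = _; rw [hΨZg]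
  have hi₂Zemb : Manifold.IsSmoothEmbedding 𝓘(ℝ, 𝔼 3) IZ ∞ i₂Z :=
    hφ.comp_openPartialHomeomorph ΨZ hΨZsrc (by rw [hΨZg, hΨZsrc]; exact hgZemb.contMDiff.contMDiffOn)
      (by rw [hΨZtgt]; exact contMDiffOn_symm_of_isSmoothEmbedding hgZemb hgZo)
  have hi₂Z0 : i₂Z 0 = φZ ⟨-N, hNmem⟩ := by
    rw [hi₂Zapp]
    congr 1
    apply Subtype.ext
    change D'.i₂ (lam 0) = -N
    rw [hlam0, ConnectedSumSphereData.i₂_zero]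
  have hP : ((puncture i₂Z : TopologicalSpace.Opens Z) : Set Z) = {φZ ⟨-N, hNmem⟩}ᶜ := by
    rw [coe_puncture, hi₂Z0]
  -- the embedding `β : Z ∖ {φ_Z (-N)} ↪ Y`
  obtain ⟨jBP, hjBP, hjBPo, hjBPA, hjBPB, hjBPrange⟩ := exists_betaEmbedding ν hA hAo hB hrel νZ LZ
    hφ hφo hψ hψo hcovZ hrelZ hNmem hq₀ν hμs hμinvs hμo hleft hμmemL Fs Fw hFw T hT hμν
    (puncture i₂Z) hP
  -- the relation: preliminaries
  have hbig : ∀ w : 𝔼 3, 4 < ‖w‖ → 2 < ‖(16 : ℝ) • g w‖ := by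
    intro w hw
    rw [norm_smul, Real.norm_eq_abs, abs_of_pos (by norm_num : (0 : ℝ) < 16), hg, norm_ballContraction]
    have h1 : ballProfile 4 < ballProfile ‖w‖ :=
      strictMonoOn_ballProfile (by norm_num : (4 : ℝ) ∈ Ioi 0) (show ‖w‖ ∈ Ioi (0 : ℝ) by
        change (0 : ℝ) < ‖w‖; linarith) hw
    rw [ballProfile_four] at h1
    linarith
  have hfour : ∀ (u : 𝔼 3) {t : ℝ}, ‖u‖ = 1 → t ∈ Ioo (0 : ℝ) 1 → 4 < ‖(4 / (1 - t)) • u‖ := by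
    intro u t hu ht
    have h1t : 0 < 1 - t := by linarith [ht.2]
    rw [norm_smul, hu, mul_one, Real.norm_eq_abs, abs_of_pos (by positivity), lt_div_iff₀ h1t]
    nlinarith [ht.1]
  -- the unit tube of `ν none` lies in `C`
  have htube₀ : ∀ {a : 𝕊 3} {b : (𝔼 2) × (𝕊 1)}, (ν none).glueRel a b → a ∈ C := fun {a b} h ↦ by
    obtain ⟨x, w, -, rfl⟩ := h.exists_eq_apply
    rw [hν₀]
    refine ⟨_, ?_, rfl⟩
    rw [Metric.mem_closedBall, dist_zero_right]
    exact (norm_flatTubeS_lt_two hh₀ hδ hδ4 _).le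
  -- the value of `α` on the disc
  have hαval : ∀ (a : ↥(puncture D'.i₁)) {u : 𝔼 3} {t : ℝ}, ‖u‖ = 1 → t ∈ Ioo (0 : ℝ) 1 →
      (a : Y') = D'.i₁ (t • u) → (D'.α a : Y') = D'.i₁ (g ((4 / (1 - t)) • u)) := by
    intro a u t hu ht ha
    have has : (a : Y') ∈ D'.Φ.source := ha ▸ D'.i₁_mem_source _
    rw [ConnectedSumSphereData.coe_α, chartTransport_of_mem _ has, ha, D'.Φ_i₁,
      punctureExpansion_smul_eq hu ht]
    rfl
  -- the value of `μ` on the round disc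
  have hμi₂ : ∀ {u : 𝔼 3} {t : ℝ}, ‖u‖ = 1 → t ∈ Ioo (0 : ℝ) 1 →
      μ (D'.i₂ ((1 - t) • u)) = Φ₀.Γ ((16 : ℝ) • g ((4 / (1 - t)) • u)) := by
    intro u t hu ht
    rw [hμf]
    change Φ₀.Γ ((16 : ℝ) • g (S₀.symm (D'.c (D'.i₂ ((1 - t) • u))))) = _
    rw [D'.c_i₂_smul hu ht.2, map_smul, LinearIsometryEquiv.symm_apply_apply]
  refine ⟨D'.i₁, i₂Z, D'.isSmoothEmbedding_i₁, hi₂Zemb, ιU ∘ D'.α, jBP,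
    isSmoothEmbedding_comp_diffeomorph hιU D'.α, ?_, hjBP, hjBPo, ?_, fun a b ↦ ?_⟩
  · rw [range_comp, (EquivLike.surjective D'.α).range_eq, image_univ]; exact hιUo
  · -- the cover
    refine eq_univ_of_forall fun y ↦ ?_
    rw [range_comp, (EquivLike.surjective D'.α).range_eq, image_univ, hιUrange, hjBPrange]
    have hy : y ∈ range jA ∪ ⋃ i, range (jB i) := hcov ▸ mem_univ _
    simp only [mem_union, mem_iUnion, mem_range] at hy
    rcases hy with ⟨a, rfl⟩ | ⟨(_ | i), b, rfl⟩
    · by_cases haC : (a : 𝕊 3) ∈ C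
      · obtain ⟨v, hv, hva⟩ := haC
        rw [Metric.mem_closedBall, dist_zero_right] at hv
        have hvfc : v ∉ range flatCircle := by
          rintro ⟨u, rfl⟩
          exact (Link.mem_complement_iff L (a : 𝕊 3)).1 a.2 none ⟨u, by
            rw [← hva]; exact (Φ₀.apply_flatCircle u).symm⟩
        obtain ⟨a₀, ha₀O, ha₀N, ha₀⟩ := hμcov v hv hvfc
        refine Or.inr (Or.inl ⟨⟨μ a₀, hμmemL a₀ ha₀O ha₀N⟩, ⟨a₀, ha₀O, ha₀N, rfl⟩, ?_⟩)
        congr 1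
        exact Subtype.ext (ha₀.trans hva)
      · exact Or.inl (Or.inl ⟨a, haC, rfl⟩)
    · exact Or.inr (Or.inr ⟨b, rfl⟩)
    · exact Or.inl (Or.inr (mem_iUnion.2 ⟨i, b, rfl⟩))
  · -- the relation
    constructor
    · intro heq
      have hmemA : (ιU ∘ D'.α) a ∈ range ιU := ⟨_, rfl⟩
      have hmemB : jBP b ∈ range jBP := mem_range_self _
      rw [hιUrange] at hmemA
      rw [hjBPrange] at hmemB
      rw [heq] at hmemA
      rcases hmemA with ⟨a', ha'C, ha'⟩ | htori
      · rcases hmemB with ⟨a'', ⟨a₀, ha₀O, ha₀N, ha''⟩, hb''⟩ | ⟨b₀, hb₀⟩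
        · -- the main case
          have haa : a' = a'' := hA.isEmbedding.injective (ha'.trans hb''.symm)
          have ha'μ : (a' : 𝕊 3) = μ a₀ := by rw [haa]; exact ha''
          set x₀ := S₀.symm (σ (R a₀)) with hx₀
          have hμa₀ : μ a₀ = Φ₀.Γ ((16 : ℝ) • g x₀) := hμf a₀
          have hbigx : 2 < ‖(16 : ℝ) • g x₀‖ := by
            by_contra hle
            exact ha'C (by rw [ha'μ, hμa₀]; exact ⟨_, by
              rw [Metric.mem_closedBall, dist_zero_right]; exact not_lt.1 hle, rfl⟩)
          -- `α a = jA' ã`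
          set ã : L.someLink.complement := ⟨μ a₀, by rw [hμa₀]; exact hΓmem _⟩ with hã
          have hãU : jA' ã ∈ D'.Uα := by
            rw [← SetLike.mem_coe, hUα]
            rintro ⟨a₁, ha₁C, ha₁⟩
            have : a₁ = ã := hA'.isEmbedding.injective ha₁
            rw [this] at ha₁C
            exact ha'C (by rw [ha'μ]; exact ha₁C)
          have hαa : D'.α a = ⟨jA' ã, hãU⟩ := by
            apply hιU.isEmbedding.injective
            rw [hιUA ã (by rw [hã]; exact hμmemL a₀ ha₀O ha₀N) hãU]
            change (ιU ∘ D'.α) a = _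
            rw [heq, ← hb'']
            congr 1
            exact Subtype.ext ha''
          have hαa' : (D'.α a : Y') = jA' ã := congrArg Subtype.val hαa
          -- `a ∈ Φ.source`
          have has : (a : Y') ∈ D'.Φ.source := by
            by_contra hnot
            have h1 : (D'.α a : Y') = a := by
              rw [ConnectedSumSphereData.coe_α, chartTransport_of_not_mem _ hnot]
            have h2 : (a : Y') = D'.i₁ ((16 : ℝ)⁻¹ • ((16 : ℝ) • g x₀)) := by
              rw [← h1, hαa', hi₁, smul_smul, mul_inv_cancel₀ (by norm_num : (16 : ℝ) ≠ 0), one_smul]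
              congr 1
              exact Subtype.ext hμa₀
            exact hnot (h2 ▸ D'.i₁_mem_source _)
          set z := D'.Φ a with hz
          have haz : (a : Y') = D'.i₁ z := (D'.i₁_Φ has).symm
          have hz0 : z ≠ 0 := D'.Φ_ne_zero has a.2
          have hhg : punctureExpansion z = g x₀ := by
            have h1 : (D'.α a : Y') = D'.i₁ (punctureExpansion z) := by
              rw [ConnectedSumSphereData.coe_α, chartTransport_of_mem _ has]; rfl
            rw [hαa', hi₁] at h1
            have h2 := congrArg Subtype.val (hA'.isEmbedding.injective h1)
            change μ a₀ = Φ₀.Γ ((16 : ℝ) • punctureExpansion z) at h2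
            rw [hμa₀] at h2
            exact smul_right_injective _ (by norm_num : (16 : ℝ) ≠ 0) (hΓinj h2).symm
          have hn1 : ‖z‖ < 1 := by
            refine norm_lt_one_of_norm_punctureExpansion_lt_one hz0 ?_
            rw [hhg]; exact norm_ballContraction_lt_one _
          set t : ℝ := ‖z‖ with ht
          have ht0 : 0 < t := norm_pos_iff.mpr hz0
          set u : 𝔼 3 := t⁻¹ • z with hu
          have hu1 : ‖u‖ = 1 := by
            rw [hu, norm_smul, norm_inv, Real.norm_of_nonneg ht0.le, inv_mul_cancel₀ ht0.ne']
          have hzu : z = t • u := by rw [hu, smul_smul, mul_inv_cancel₀ ht0.ne', one_smul]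
          refine ⟨u, t, hu1, ⟨ht0, hn1⟩, by rw [← hzu]; exact haz, ?_⟩
          -- identify `a₀`
          have h1 : g x₀ = g ((4 / (1 - t)) • u) := by rw [← hhg, hzu, punctureExpansion_smul_eq hu1 ⟨ht0, hn1⟩]
          have h2 : D'.c a₀ = (4 / (1 - t)) • S₀ u := by
            have h3 := congrArg S₀ (injective_ballContraction h1)
            rw [hx₀, LinearIsometryEquiv.apply_symm_apply, map_smul] at h3
            exact h3
          rw [← D'.c_i₂_smul hu1 hn1] at h2
          have hb₀ : D'.i₂ ((1 - t) • u) ≠ -D'.v := by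
            rw [← ConnectedSumSphereData.i₂_zero]
            intro h5
            have h6 : (1 - t) • u = 0 := D'.injective_i₂ h5
            rw [smul_eq_zero] at h6
            rcases h6 with h6 | h6
            · linarith
            · rw [h6, norm_zero] at hu1; exact zero_ne_one hu1
          have ha₀v : a₀ ≠ -D'.v := ha₀N
          have h4 : poleReflectionSphere (n := 3) D'.v a₀ =
              poleReflectionSphere (n := 3) D'.v (D'.i₂ ((1 - t) • u)) :=
            (stereographic' 3 D'.v).injOn (D'.poleReflectionSphere_mem_source ha₀v)
              (D'.poleReflectionSphere_mem_source hb₀) h2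
          have h5 : a₀ = D'.i₂ ((1 - t) • u) := by
            have := congrArg (poleReflectionSphere (n := 3) D'.v) h4
            rwa [poleReflectionSphere_poleReflectionSphere, poleReflectionSphere_poleReflectionSphere] at this
          -- identify `b`
          have hmemb : φZ ⟨a₀, ha₀O⟩ ∈ (puncture i₂Z : TopologicalSpace.Opens Z) := by
            rw [← SetLike.mem_coe, hP]
            intro h6
            exact ha₀N (congrArg Subtype.val (hφ.isEmbedding.injective h6))
          have h6 : jBP ⟨φZ ⟨a₀, ha₀O⟩, hmemb⟩ = jBP b := by
            rw [hjBPA ⟨a₀, ha₀O⟩ ha₀N hmemb, ← hb'']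
            congr 1
            exact Subtype.ext ha''.symm
          have h7 := congrArg Subtype.val (hjBP.isEmbedding.injective h6)
          change φZ ⟨a₀, ha₀O⟩ = (b : Z) at h7
          rw [← h7, hi₂Zapp]
          congr 1
          apply Subtype.ext
          change a₀ = D'.i₂ (lam ((1 - t) • u))
          rw [hlamid _ (by
            rw [norm_smul, hu1, mul_one, Real.norm_of_nonneg (by linarith)]; linarith), h5]
        · -- `jB b` in the solid torus of `K₀`: then `a'` lies in `C`
          exfalso
          have h1 : jA a' = jB none b₀ := ha'.trans hb₀.symm
          rw [hrel] at h1
          exact ha'C (htube₀ h1)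
      · obtain ⟨i, b₁, hb₁⟩ : ∃ i b₁, jB (some i) b₁ = jBP b := by
          simpa only [mem_iUnion, mem_range] using htori
        exfalso
        rcases hmemB with ⟨a'', ⟨a₀, ha₀O, ha₀N, ha''⟩, hb''⟩ | ⟨b₀, hb₀⟩
        · have h1 : jA a'' = jB (some i) b₁ := hb''.trans hb₁.symm
          rw [hrel] at h1
          obtain ⟨x, w, hw, hxw⟩ := h1.exists_eq_apply
          refine hΓν i x w hw ?_
          rw [← hxw, ha'', hμf]
          exact mem_range_self _
        · exact Set.disjoint_left.1 (hdisj (Option.some_ne_none i)) (mem_range_self b₁)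
            (hb₁.trans hb₀.symm ▸ mem_range_self b₀)
    · rintro ⟨u, t, hu, ht, ha, hb⟩
      have hlamtu : lam ((1 - t) • u) = (1 - t) • u :=
        hlamid _ (by rw [norm_smul, hu, mul_one, Real.norm_of_nonneg (by linarith [ht.2])]; linarith [ht.1])
      have hmemZ : D'.i₂ ((1 - t) • u) ∈ (unknot).complement := by
        have h := hi₂mem ((1 - t) • u); rwa [hlamtu] at h
      -- `jA a`
      have hαa : (D'.α a : Y') = jA' ⟨Φ₀.Γ ((16 : ℝ) • g ((4 / (1 - t)) • u)), hΓmem _⟩ := by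
        rw [hαval a hu ht ha, hi₁]
      have hãC : Φ₀.Γ ((16 : ℝ) • g ((4 / (1 - t)) • u)) ∉ C := hnotC _ (hbig _ (hfour u hu ht))
      have hãU : jA' ⟨Φ₀.Γ ((16 : ℝ) • g ((4 / (1 - t)) • u)), hΓmem _⟩ ∈ D'.Uα := by
        rw [← SetLike.mem_coe, hUα]
        rintro ⟨a₁, ha₁C, ha₁⟩
        have := hA'.isEmbedding.injective ha₁
        rw [this] at ha₁C
        exact hãC ha₁C
      have hãL : Φ₀.Γ ((16 : ℝ) • g ((4 / (1 - t)) • u)) ∈ L.complement := by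
        rw [Link.mem_complement_iff]
        rintro (_ | i) hx
        · exact hãC (hKC hx)
        · exact (Link.mem_complement_iff _ _).1 (hΓmem _) i (by simpa using hx)
      have h1 : (ιU ∘ D'.α) a = jA ⟨Φ₀.Γ ((16 : ℝ) • g ((4 / (1 - t)) • u)), hãL⟩ := by
        have h2 : D'.α a = ⟨_, hãU⟩ := Subtype.ext hαa
        rw [comp_apply, h2, hιUA _ hãL hãU]
      -- `jB b`
      have hb' : (b : Z) = φZ ⟨D'.i₂ ((1 - t) • u), hmemZ⟩ := by
        rw [hb, hi₂Zapp]
        congr 1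
        apply Subtype.ext
        change D'.i₂ (lam ((1 - t) • u)) = D'.i₂ ((1 - t) • u)
        rw [hlamtu]
      have hb₀ : D'.i₂ ((1 - t) • u) ≠ -N := by
        change D'.i₂ ((1 - t) • u) ≠ -D'.v
        rw [← ConnectedSumSphereData.i₂_zero]
        intro h5
        have h6 : (1 - t) • u = 0 := D'.injective_i₂ h5
        rw [smul_eq_zero] at h6
        rcases h6 with h6 | h6
        · linarith [ht.2]
        · rw [h6, norm_zero] at hu; exact zero_ne_one hu
      have hmemb : φZ ⟨D'.i₂ ((1 - t) • u), hmemZ⟩ ∈ (puncture i₂Z : TopologicalSpace.Opens Z) :=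
        hb' ▸ b.2
      have h2 : jBP b = jA ⟨μ (D'.i₂ ((1 - t) • u)), hμmemL _ hmemZ hb₀⟩ := by
        have h3 : b = ⟨_, hmemb⟩ := Subtype.ext hb'
        rw [h3, hjBPA ⟨_, hmemZ⟩ hb₀ hmemb]
      rw [h1, h2]
      congr 1
      apply Subtype.ext
      change Φ₀.Γ ((16 : ℝ) • g ((4 / (1 - t)) • u)) = μ (D'.i₂ ((1 - t) • u))
      rw [hμi₂ hu ht]

end Core

/-! ### Surgery on a split link: existence together with the connected-sum decomposition -/

/-- **Surgery on a split link is the connected sum of the surgeries** (Gompf–Stipsicz (1999),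
§5.1 and §5.3; Rolfsen (1976), §9.F; Kervaire–Milnor (1963), §2). Let the component
`K₀ = L.component none` of the link `L` bound a smoothly embedded disc `d(D̄²)` missing the other
components, let the framing of `K₀` be `0`, and let `Y'` be the surgery on the remaining framed
components `L.someLink`. Then the surgery `Y` on the whole framed link exists (a closed
`3`-manifold) and **`Y` is a connected sum `Y' # (S² × S¹)`** — the `0`-framed split unknot
contributes the summand `S³_0(unknot) = S² × S¹`. Proof: flatten `K₀` by a global flattening
chart inside a neighbourhood `W` of the disc off the other components (`exists_flatChart_univ`),
take the flat tube of framing `0` for `K₀` and tubes off `W̄` for the other components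
(`shrink_holds`, `exists_trim`), build `Y` (`Link.exists_isSurgeryPresentation`), present
`S² × S¹` as `0`-surgery on the unknot with the flat tube of the global flattening chart of the
unknot (`exists_isOpenGluing_sphereTwoProdCircle`), and apply the relative standard model
`isConnectedSum_of_splitData`. [cite: GompfStipsicz1999, §5.1  §5.3] -/
theorem Link.exists_surgery_isConnectedSum_of_smoothDisc {ι : Type*} [Finite ι]
    (L : Link (Option ι)) (m : Option ι → ℤ) (hm : m none = 0) {d : 𝔼 2 → 𝕊 3}
    (hd : IsSmoothDisc d) (hdK : ∀ x : 𝕊 1, d x = L.component none x)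
    (hdisj : ∀ i : ι, Disjoint (d '' Metric.closedBall 0 1) (range (L.component (some i))))
    (Y' : Type) [TopologicalSpace Y'] [T2Space Y'] [ChartedSpace (𝔼 3) Y']
    [IsManifold (𝓡 3) ∞ Y'] (hY' : IsIntegralSurgeryLink (𝓡 3) Y' L.someLink fun i ↦ m (some i)) :
    ∃ (Y : Type) (_ : TopologicalSpace Y) (_ : T2Space Y) (_ : SecondCountableTopology Y)
      (_ : ChartedSpace (𝔼 3) Y) (_ : IsManifold (𝓡 3) ∞ Y) (_ : CompactSpace Y),
      IsIntegralSurgeryLink (𝓡 3) Y L m ∧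
        IsConnectedSum (𝓡 3) (𝓡 3) ((𝓡 2).prod (𝓡 1)) Y' ((𝕊 2) × (𝕊 1)) Y := by
  -- the other components and a neighbourhood `W` of the disc off them
  set Kset : Set (𝕊 3) := ⋃ i : ι, range (L.component (some i)) with hKset
  have hKc : IsClosed Kset :=
    isClosed_iUnion_of_finite fun i ↦ (L.component (some i)).isClosed_range
  have hDc : IsClosed (d '' Metric.closedBall 0 1) :=
    ((isCompact_closedBall _ _).image hd.1.continuous).isClosed
  have hDK : d '' Metric.closedBall 0 1 ⊆ Ksetᶜ := by
    intro p hp hpK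
    obtain ⟨i, hi⟩ := mem_iUnion.1 hpK
    exact Set.disjoint_left.1 (hdisj i) hp hi
  obtain ⟨W, hWo, hDW, hWK⟩ := normal_exists_closure_subset hDc hKc.isOpen_compl hDK
  -- a global flattening chart of `K₀` inside `W`
  obtain ⟨Φ₀₀, hΦ₀₀⟩ := Knot.existsFlatChart_holds (L.component none) d hd hdK
  have hΦW : Φ₀₀.Γ '' BlowDownFlat.flatDisc ⊆ W := by
    rintro _ ⟨p, ⟨hz, hr⟩, rfl⟩
    have hxy : ‖xy p‖ ≤ 1 := by
      rw [← Real.sqrt_sq (norm_nonneg _), ← sq_add_sq_eq_norm_xy_sq, Real.sqrt_le_one]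
      exact hr
    have hp : p = mk3 (xy p) 0 := by rw [← hz, mk3_xy]
    rw [hp, hΦ₀₀ _ hxy]
    exact hDW ⟨xy p, by rwa [Metric.mem_closedBall, dist_zero_right], rfl⟩
  obtain ⟨Φ₀, hΩ, hΓW, -⟩ := Φ₀₀.exists_flatChart_univ hWo hΦW
  -- the flat tube of `K₀`
  obtain ⟨D₀⟩ := Φ₀.nonempty_modelData isOpen_univ (subset_univ _)
  have hν₀W : range D₀.nbhd ⊆ W := by
    rintro _ ⟨q, rfl⟩
    rw [D₀.nbhd_apply]
    exact hΓW (mem_range_self _)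
  -- the unknot side: the flat tube of the global flattening chart of the unknot, same thickness
  obtain ⟨N, S₀, ΦZ, -, hΩZ, hΓZ, hcircle⟩ := exists_flatChart_unknot
  obtain ⟨DZ, hDZ⟩ : ∃ DZ : ΦZ.ModelData univ, DZ.δ = D₀.δ :=
    ⟨⟨D₀.δ, D₀.C, D₀.δ_pos, D₀.δ_le, D₀.contDiff_σ, D₀.isCompact_supp,
      by rw [hΩZ]; exact subset_univ _, subset_univ _, D₀.η, D₀.δ_le_η,
      by rw [hΩZ]; exact subset_univ _⟩, rfl⟩
  have hνZapp : ∀ q, DZ.nbhd q = poleReflectionSphere (n := 3) N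
      ((stereographic' 3 N).symm (S₀ ((2 : ℝ) • flatTubeS DZ.hand D₀.δ q))) := fun q ↦ by
    rw [DZ.nbhd_apply, hΓZ, hDZ]
  obtain ⟨φZ, ψZ, hφ, hφo, hψ, hψo, hcovZ, hrelZ⟩ :=
    exists_isOpenGluing_sphereTwoProdCircle DZ.nbhd DZ.hasFraming_nbhd
  -- the presentation of `Y'`, shrunk and trimmed off `closure W`
  obtain ⟨ν', hfr', hdisj', hpres'⟩ := hY'
  have hKV : ∀ i, range (L.someLink.component i) ⊆ (closure W)ᶜ := fun i x hx hxW ↦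
    hWK hxW (mem_iUnion.2 ⟨i, hx⟩)
  obtain ⟨ν₁, hfr₁, hr₁, hV₁, hpres₁⟩ := Link.IsSurgeryPresentation.shrink_holds ν' hfr' hdisj'
    hpres' (fun _ ↦ (closure W)ᶜ) (fun _ ↦ isClosed_closure.isOpen_compl) hKV
  choose ν₂ hν₂eq hν₂V hν₂r hν₂fr using fun i ↦
    (ν₁ i).exists_trim isClosed_closure.isOpen_compl (hV₁ i)
  set ν : ∀ i, Knot.TubularNbhd (L.component i) := Link.optionNbhd D₀.nbhd ν₂ with hν
  have hνnone : ν none = D₀.nbhd := rfl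
  have hνsome : ∀ i, ν (some i) = ν₂ i := fun i ↦ rfl
  have hdisjν : Pairwise fun i j ↦ Disjoint (range (ν i)) (range (ν j)) := by
    rintro (_ | i) (_ | j) hij
    · exact absurd rfl hij
    · rw [hνnone, hνsome]
      exact Set.disjoint_left.2 fun x hx hx' ↦ hν₂V j hx' (subset_closure (hν₀W hx))
    · rw [hνnone, hνsome]
      exact Set.disjoint_left.2 fun x hx hx' ↦ hν₂V i hx (subset_closure (hν₀W hx'))
    · rw [hνsome, hνsome]
      exact (hdisj' fun h ↦ hij (congrArg some h)).mono ((hν₂r i).trans (hr₁ i).subset)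
        ((hν₂r j).trans (hr₁ j).subset)
  -- the surgery `Y`
  obtain ⟨Y, _, _, _, _, _, _, hpres⟩ := Link.exists_isSurgeryPresentation L ν hdisjν
  obtain ⟨jA, jB, hA, hAo, hB, hcov, hdisjB, hrel⟩ := hpres
  obtain ⟨jA', jB', hA', hAo', hB', hcov', hdisjB', hrel'⟩ := hpres₁
  have hrel'' : ∀ i a b, jA' a = jB' i b ↔ Link.surgeryRel (fun i ↦ ν (some i)) i a b := by
    intro i a b
    rw [hrel']
    change (ν₁ i).glueRel (a : 𝕊 3) (b : (𝔼 2) × (𝕊 1)) ↔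
      (ν₂ i).glueRel (a : 𝕊 3) (b : (𝔼 2) × (𝕊 1))
    constructor
    · rintro ⟨u, t, ht, hb, ha⟩
      exact ⟨u, t, ht, hb, by rw [hν₂eq i u _ (norm_smul_coe_sphere_lt_one ht _).le]; exact ha⟩
    · rintro ⟨u, t, ht, hb, ha⟩
      exact ⟨u, t, ht, hb, by rw [← hν₂eq i u _ (norm_smul_coe_sphere_lt_one ht _).le]; exact ha⟩
  refine ⟨Y, ‹_›, ‹_›, ‹_›, ‹_›, ‹_›, ‹_›,
    ⟨ν, ?_, hdisjν, jA, jB, hA, hAo, hB, hcov, hdisjB, hrel⟩, ?_⟩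
  · rintro (_ | i)
    · rw [hm, hνnone]; exact D₀.hasFraming_nbhd
    · rw [hνsome]; exact (hν₂fr i _).2 (hfr₁ i)
  -- the connected sum: the hypotheses of the relative standard model
  have hΓmem : ∀ y, Φ₀.Γ y ∈ L.someLink.complement := fun y ↦
    (Link.mem_complement_iff _ _).2 fun i hy ↦
      hWK (subset_closure (hΓW (mem_range_self y))) (mem_iUnion.2 ⟨i, hy⟩)
  have hΓν : ∀ (i : ι) (x : 𝕊 1) (w : 𝔼 2), ‖w‖ < 1 → ν (some i) (x, w) ∉ range Φ₀.Γ :=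
    fun i x w _ h ↦ hν₂V i (mem_range_self _) (subset_closure (hΓW h))
  have hν₀ : ∀ q, ν none q = Φ₀.Γ (flatTubeS D₀.hand D₀.δ q) := fun q ↦ D₀.nbhd_apply q
  -- the two handednesses
  have hsq : DZ.hand ^ 2 = D₀.hand ^ 2 := by rw [DZ.hand_sq, D₀.hand_sq]
  rcases sq_eq_sq_iff_eq_or_eq_neg.1 hsq with h1 | h1
  · exact isConnectedSum_of_splitData ν hA hAo hB hcov hdisjB hrel hA' hAo' hB' hcov' hdisjB'
      hrel'' Φ₀ hΩ hΓmem hΓν D₀.hand_sq DZ.hand_sq D₀.δ_pos D₀.δ_le hν₀ N S₀ hcircle DZ.nbhd hνZapp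
      id id (fun _ _ ↦ rfl) (Diffeomorph.refl _ _ _) (fun _ ↦ rfl)
      (fun x w ↦ by simp only [flatTubeS_apply, h1]; rfl) solidTorusModelIso hφ hφo hψ hψo hcovZ
      hrelZ
  · exact isConnectedSum_of_splitData ν hA hAo hB hcov hdisjB hrel hA' hAo' hB' hcov' hdisjB'
      hrel'' Φ₀ hΩ hΓmem hΓν D₀.hand_sq DZ.hand_sq D₀.δ_pos D₀.δ_le hν₀ N S₀ hcircle DZ.nbhd hνZapp
      (reflectLast 1) planeFlip (fun t v ↦ by rw [map_smul, planeFlip_coe_sphere])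
      solidTorusCircleFlip (fun b ↦ by rw [coe_solidTorusCircleFlip, circleFactorFlip_apply])
      (fun x w ↦ by simp only [flatTubeS_apply, h1, flatTube_planeFlip])
      solidTorusModelIso hφ hφo hψ hψo hcovZ hrelZ

/-! ### The discharge: surgery on the `0`-framed unlink -/

/-- **Surgery on the empty framed link is `S³`**: no tubes, the link complement is all of `S³`,
embedded by the inclusion. Rolfsen (1976), §9.F. [folklore] -/
theorem FramedLink.isSurgery_sphereThree_of_isEmpty {ι : Type*} [Finite ι] [IsEmpty ι]
    (U : FramedLink ι) : U.IsSurgery (𝓡 3) (𝕊 3) := by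
  refine ⟨fun i ↦ isEmptyElim i, fun i ↦ isEmptyElim i, fun i ↦ isEmptyElim i, Subtype.val,
    fun i ↦ isEmptyElim i, Manifold.IsSmoothEmbedding.of_opens _, ?_, fun i ↦ isEmptyElim i, ?_,
    fun i ↦ isEmptyElim i, fun i ↦ isEmptyElim i⟩
  · rw [Subtype.range_coe]; exact U.toLink.complement.isOpen
  · rw [Subtype.range_coe, iUnion_of_empty, union_empty]
    exact eq_univ_of_forall fun x ↦ (Link.mem_complement_iff _ _).2 fun i ↦ isEmptyElim i

/-- The round spheres `𝕊ⁿ`, `n ≥ 1`, are connected (`isConnected_sphere`). [folklore] -/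
theorem connectedSpace_sphere_succ (n : ℕ) :
    ConnectedSpace (Metric.sphere (0 : EuclideanSpace ℝ (Fin (n + 2))) 1) := by
  refine isConnected_iff_connectedSpace.mp (isConnected_sphere ?_ 0 zero_le_one)
  rw [← Module.finrank_eq_rank, finrank_euclideanSpace_fin]
  exact_mod_cast Nat.lt_of_sub_eq_succ rfl

/-- **Surgery on the `0`-framed unlink is `#ⁿ (S² × S¹)`** — discharge of
`exists_isSurgery_zeroFramedUnlink` (Gompf–Stipsicz (1999), §5.1, §5.3: each split `0`-framed
unknot contributes a connected summand `S³_0(unknot) = S² × S¹`; induction on the number of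
components via `Link.exists_surgery_isConnectedSum_of_smoothDisc`).
[cite: GompfStipsicz1999, §5.1  §5.3] -/
theorem exists_isSurgery_zeroFramedUnlink_holds : exists_isSurgery_zeroFramedUnlink := by
  intro n
  induction n with
  | zero =>
    intro U _
    haveI : ConnectedSpace (𝕊 3) := connectedSpace_sphere_succ 2
    exact ⟨𝕊 3, inferInstance, inferInstance, inferInstance, inferInstance, inferInstance,
      inferInstance, inferInstance, ⟨Diffeomorph.refl _ _ _⟩, U.isSurgery_sphereThree_of_isEmpty⟩
  | succ k ih =>
    intro U hU
    obtain ⟨⟨dU, hdU, hdisjU⟩, hfrU⟩ := hU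
    set e : Option (Fin k) ≃ Fin (k + 1) := (finSuccEquiv k).symm with he
    set LU : FramedLink (Option (Fin k)) := U.reindex e with hLU
    set U' : FramedLink (Fin k) := ⟨LU.toLink.someLink, fun i ↦ LU.framing (some i)⟩ with hU'
    have hU'0 : U'.IsZeroFramedUnlink :=
      ⟨⟨fun i ↦ dU (e (some i)), fun i ↦ ⟨(hdU _).1, fun x ↦ (hdU _).2 x⟩, fun i j hij ↦
        hdisjU fun h ↦ hij (Option.some_injective _ (e.injective h))⟩, fun i ↦ hfrU _⟩
    obtain ⟨Y', _, _, _, _, _, _, _, hsum', hsur'⟩ := ih U' hU'0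
    have hrange : ∀ j, range (U.component j) ⊆ dU j '' Metric.closedBall 0 1 := by
      rintro j _ ⟨x, rfl⟩
      refine ⟨x, ?_, (hdU j).2 x⟩
      rw [Metric.mem_closedBall, dist_zero_right, norm_eq_of_mem_sphere x]
    obtain ⟨Y, _, _, _, _, _, _, hY, hcs⟩ :=
      LU.toLink.exists_surgery_isConnectedSum_of_smoothDisc LU.framing (hfrU _) (hdU (e none)).1
        (fun x ↦ (hdU (e none)).2 x)
        (fun i ↦ (hdisjU (e.injective.ne (Option.some_ne_none i).symm)).mono_right (hrange _))
        Y' hsur'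
    haveI : ConnectedSpace (𝕊 2) := connectedSpace_sphere_succ 1
    haveI : ConnectedSpace (𝕊 1) := connectedSpace_sphere_succ 0
    haveI : ConnectedSpace Y := IsConnectedSum.connectedSpace_holds
      (by rw [finrank_euclideanSpace_fin]; norm_num) hcs
    exact ⟨Y, ‹_›, ‹_›, ‹_›, ‹_›, ‹_›, ‹_›, ‹_›, ⟨Y', ‹_›, ‹_›, ‹_›, ‹_›, hsum', hcs⟩,
      (FramedLink.isSurgery_reindex_iff_holds e U).1 hY⟩

end Literature.Topology.FourManifolds
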